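import Summits.ABC.StewartYu.ArchG3StartSat
import Summits.ABC.StewartYu.ArchG3RecSched
import Summits.ABC.StewartYu.ArchG3PackClosed
import HarnessLib

/-!
# Cell abc-stewartyu, rung A1.L (crux r2 `ArchCoreRat`), WP-L.A: the START of the one-stage line AT `S(θ)` ON THE RECORD LETTERS
# (`ArchG3Rec` / `ArchG3RecSched`) — every slot of `archLevelStateQ_zero_sat` in closed form, ONE numeric hypothesis left (the Siegel line)

`Summits/ABC/StewartYu/ArchG3StartRec.lean` — cell `abc-stewartyu` (HOME `run/shared/lean/pub/abc-stewartyu/`; p1 g11 ask (r2-a) STATUS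
2026-08-27 19:49:57Z, «MINE (r2-a)» lp-1 20:0xZ).  Five small definitions (schedule letters of the START: the doubled virtual box `LνR`, the
θ-radius `sθR`, the uniform Hasse size `M₀R`, the largest virtual monomial denominator `DmvR` over the level-`0` nodes, the Siegel size
`AmaxR`) and theorems on `ArchG3Setup`; no named fact.  From the record of reference `P : ArchG3Rec n` (seat p1), its schedule letters
`Nf/Tf/wl/γb/σ/Bv` (`ArchG3RecSched`), the saturated data `F : S.SatData` at `S(θ)` with `P.N = F.N` and `|log α°ⱼ| ≤ Aⱼ`, and a
Δ-basis schedule `(cl, el)` with `cl 0 ≠ 0`, `el 0 j₀ = 0`: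

* `LνR P : ℕ → Fin n → ℕ` — `LνR 0 j = 2·Bv j + 1 ≥ ⌊2Nσⱼ⌋`, halved (`ℕ`-division) at every level; `sθR F P k = (Σⱼ LνR 0 j·|C j k|)/N + 2`;
  `M₀R P = ⌈ν(H)^{T₀}·WC H Ŝ L₀ T₀ X₀⌉` (`X₀ = Nf 0 0`, `T₀ = Tf 0 0`); `DmvR F P = max_{|x| ≤ X₀} Dmv (LνR 0) x`;
  `AmaxR F P c e = max 1 (DΔC (YC c e (2·sθR)) T₀ · M₀R · DmvR · e^{wl 0·X₀})`;
* **`archLevelStateQ_zero_rec`** — under the ONE numeric hypothesis (the Siegel line, record arithmetic)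
  `(L1) 2·((2X₀+1)·C(T₀+n−1, n))·(2⌈(Σⱼ σⱼ·Aⱼ)/wl 0⌉₊+1)·Nⁿ ≤ (L₀+1)·|det C|·∏ⱼ(2⌊N·σⱼ⌋₊+1)`:
  `∃ 𝔏 pv, (∀ i ∈ unkA L₀ 𝔏, i.1 ≤ L₀) ∧ #unkA L₀ 𝔏 ≤ (L₀+1)·∏(LνR 0 j + 1) ∧
   ArchLevelStateQ (VBoxQ (vecMulLinear U) (LνR P)) H Ŝ (sθR F P) (unkA L₀ 𝔏) pv ⌈#unkA·AmaxR⌉ wl γb cl el 0 (Nf 0 0) (Tf 0 0)`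
  — the level-`0` input of `lastLevelState_of_scheduleD` with p4's `StartAt` letters; `log P ≤ log((L₀+1)∏(LνR 0 j+1)) + log AmaxR`
  is then a letter line for the packs.

WHAT THIS IS NOT: the Siegel line (L1) and the letter bounds on `AmaxR` (record numerics, seat p1); the packs (seat p5); no crux moves.

References: Yu. V. Nesterenko, LNM 1819 (2003) §3.3 Prop. 3.4 p. 66–69, §3.5 (3.22)–(3.30) Prop. 3.9, Lemma 3.10 (3.35) p. 71–76, (3.41)–(3.44)
p. 76–78, §4 (4.6) p. 80–81 [Nesterenko2003]; E. M. Matveev, Izv. Math. 64 (2000) §3 [Matveev2000].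
-/

noncomputable section

open Finset Polynomial
open scoped Matrix Nat
open Literature.NumberTheory.Transcendental
open Literature.NumberTheory.Transcendental.CW77.Setup (Tau tauNorm tauSet)
open Summit.ABC.StewartYu.ArchSupply (scaledFeldR WC WC_nonneg exists_int_lcm_pow_mul_hasse_scaledFeldR)

namespace Summit.ABC.StewartYu

namespace ArchG3Setup

variable (S : ArchG3Setup)

/-! ### The START letters -/

/-- **The doubled virtual box schedule**: `LνR 0 j = 2·Bv j + 1` (the virtual box of DIFFERENCES of members of the translated `𝔑`-family,
`≥ ⌊2Nσⱼ⌋`), halved at every level. [cite: Nesterenko2003, §3.4–3.5 (the box of 𝔑-points), §4.3 (4.48); shape only] -/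
def LνR (P : ArchG3Rec S.n) : ℕ → Fin S.n → ℕ
  | 0 => fun j => 2 * P.Bv j + 1
  | s + 1 => fun j => LνR P s j / 2

/-- `LνR (s+1) j = LνR s j / 2`. [folklore] -/
theorem LνR_succ (P : ArchG3Rec S.n) (s : ℕ) (j : Fin S.n) : S.LνR P (s + 1) j = S.LνR P s j / 2 := rfl

/-- `LνR 0 j = 2·Bv j + 1`. [folklore] -/
theorem LνR_zero (P : ArchG3Rec S.n) (j : Fin S.n) : S.LνR P 0 j = 2 * P.Bv j + 1 := rfl

/-- **The θ-radius of the translated family**: `sθR k = (Σⱼ LνR 0 j·|C j k|)/N + 2`. [cite: Nesterenko2003, §3.5 (3.25); shape only] -/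
def sθR (F : S.SatData) (P : ArchG3Rec S.n) (k : Fin S.n) : ℕ := (∑ j, S.LνR P 0 j * (F.C j k).natAbs) / F.N + 2

/-- **The uniform Hasse size at level `0`**: `⌈ν(H)^{T₀}·WC H Ŝ L₀ T₀ X₀⌉` (`X₀ = Nf 0 0`, `T₀ = Tf 0 0`).
[cite: Nesterenko2003, §3.1 Prop. 3.1, §3.5 Lemma 3.10 (3.35), p. 73; shape only] -/
def M₀R (P : ArchG3Rec S.n) : ℤ :=
  ⌈((Nat.lcmUpto P.H : ℝ) ^ P.Tf 0 0) * WC P.H P.Sd P.L₀ (P.Tf 0 0) (P.Nf 0 0 : ℝ)⌉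

/-- **The largest virtual monomial denominator over the level-`0` nodes** `|x| ≤ Nf 0 0`. [cite: Nesterenko2003, §3.5 Lemma 3.11; shape only] -/
def DmvR (F : S.SatData) (P : ArchG3Rec S.n) : ℕ :=
  (Finset.Icc (-(P.Nf 0 0 : ℤ)) (P.Nf 0 0)).sup' ⟨0, by simp⟩ fun x => F.Dmv (S.LνR P 0) x

/-- **The Siegel size of the START**: `max 1 (DΔC (YC c e (2·sθR)) T₀ · M₀R · DmvR · e^{wl 0·X₀})`.
[cite: Nesterenko2003, §3.5 (3.37), Prop. 3.9 (3.48); shape only] -/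
def AmaxR (F : S.SatData) (P : ArchG3Rec S.n) (c : ℤ) (e : Fin S.n → ℤ) : ℝ :=
  max 1 (DΔC (S.YC c e fun j => 2 * S.sθR F P j) (P.Tf 0 0) * (S.M₀R P : ℝ) * (S.DmvR F P : ℝ) *
    Real.exp (P.wl 0 * (P.Nf 0 0 : ℕ)))

variable {S}

/-- `1 ≤ Tf 0 0` (`Mord 0 0 ≥ (n+1)·T 0 ≥ 1`). [folklore] -/
theorem one_le_Tf_zero (P : ArchG3Rec S.n) : 1 ≤ P.Tf 0 0 := by
  show 1 ≤ P.Mord 0 0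
  unfold ArchG3Rec.Mord
  have hT : 1 ≤ P.T 0 := le_max_left _ _
  have hn : 1 ≤ S.n + 1 - 0 := by omega
  calc 1 ≤ (S.n + 1 - 0) * P.T 0 := one_le_mul hn hT
    _ ≤ _ := Nat.le_add_left _ _

/-! ### The START on the record letters -/

/-- **THE START AT `S(θ)` ON THE RECORD LETTERS** (one numeric hypothesis left: the Siegel line (L1)).
[cite: Nesterenko2003, §3.3 Prop. 3.4, §3.5 (3.22)–(3.30) Prop. 3.9, Lemma 3.10–3.11, §4 (4.6), p. 66–81] -/
theorem archLevelStateQ_zero_rec (F : S.SatData) (P : ArchG3Rec S.n) (hNF : P.N = F.N)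
    (hAo : ∀ j, |Real.log (F.αo j : ℝ)| ≤ P.A j)
    (cl : ℕ → ℤ) (el : ℕ → Fin S.n → ℤ) (hc : cl 0 ≠ 0) (he : el 0 S.j₀ = 0)
    (hL1 : 2 * ((2 * P.Nf 0 0 + 1) * (P.Tf 0 0 + S.n - 1).choose S.n) * (2 * ⌈(∑ j, P.σ j * P.A j) / P.wl 0⌉₊ + 1) * F.N ^ S.n ≤
      (P.L₀ + 1) * (F.C.det.natAbs * ∏ j, (2 * ⌊(F.N : ℝ) * P.σ j⌋₊ + 1))) :
    ∃ (𝔏 : Finset (Fin S.n → ℤ)) (pv : ℕ × (Fin S.n → ℤ) → ℤ), (∀ i ∈ S.unkA P.L₀ 𝔏, i.1 ≤ P.L₀) ∧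
      (S.unkA P.L₀ 𝔏).card ≤ (P.L₀ + 1) * ∏ j, (S.LνR P 0 j + 1) ∧
      S.ArchLevelStateQ (S.VBoxQ (Matrix.vecMulLinear F.U).toAddMonoidHom (S.LνR P)) P.H P.Sd (S.sθR F P) (S.unkA P.L₀ 𝔏) pv
        ⌈((S.unkA P.L₀ 𝔏).card : ℝ) * S.AmaxR F P (cl 0) (el 0)⌉ P.wl P.γb cl el 0 (P.Nf 0 0) (P.Tf 0 0) := by
  classical
  have hn : 1 ≤ S.n := P.hn
  have hN0 : (0 : ℝ) < F.N := F.N_pos'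
  have hH : 1 ≤ P.H := le_max_left _ _
  have hT₀ : 1 ≤ P.Tf 0 0 := one_le_Tf_zero P
  set X₀ : ℕ := P.Nf 0 0 with hX₀
  set T₀ : ℕ := P.Tf 0 0 with hT₀def
  set E : Finset (ℤ × Tau S.n) := Icc (-(X₀ : ℤ)) X₀ ×ˢ tauSetR S.n S.j₀ T₀ with hEdef
  -- letters
  have hσ : ∀ j, 0 ≤ P.σ j := fun j => (P.box_facts j).1.le
  have hLν0 : ∀ j, ⌊2 * ((F.N : ℝ) * P.σ j)⌋₊ ≤ S.LνR P 0 j := by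
    intro j
    rw [S.LνR_zero]
    unfold ArchG3Rec.Bv
    rw [hNF]
    have h0 : 0 ≤ (F.N : ℝ) * P.σ j := mul_nonneg hN0.le (hσ j)
    have h1 : (F.N : ℝ) * P.σ j < ⌊(F.N : ℝ) * P.σ j⌋₊ + 1 := Nat.lt_floor_add_one _
    have h2 : ⌊2 * ((F.N : ℝ) * P.σ j)⌋₊ < 2 * ⌊(F.N : ℝ) * P.σ j⌋₊ + 2 := by
      rw [Nat.floor_lt (by positivity)]; push_cast; linarith
    omega
  have hs : ∀ k, ∑ j, (S.LνR P 0 j : ℤ) * |F.C j k| + F.N ≤ (F.N : ℤ) * S.sθR F P k := by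
    intro k
    unfold sθR
    set A : ℕ := ∑ j, S.LνR P 0 j * (F.C j k).natAbs with hA
    have hA' : ∑ j, (S.LνR P 0 j : ℤ) * |F.C j k| = (A : ℤ) := by
      rw [hA]; push_cast
      rfl
    rw [hA']
    have hNpos : 0 < F.N := F.hN
    have hdiv : (A : ℤ) < F.N * (A / F.N + 1 : ℕ) := by
      have := Nat.lt_div_mul_add hNpos (a := A)
      have h2 : A < F.N * (A / F.N + 1) := by rw [Nat.mul_add, Nat.mul_one, Nat.mul_comm]; exact this
      exact_mod_cast h2
    push_cast at hdiv ⊢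
    nlinarith
  -- the count from (L1) and `#E ≤ (2X₀+1)·C(T₀+n−1, n)`
  have hEcard : E.card ≤ (2 * X₀ + 1) * (T₀ + S.n - 1).choose S.n := by
    rw [hEdef, card_product, Int.card_Icc]
    have h1 : ((X₀ : ℤ) + 1 - -(X₀ : ℤ)).toNat = 2 * X₀ + 1 := by omega
    rw [h1]
    exact Nat.mul_le_mul_left _ (card_tauSetR_le_choose hn S.j₀ T₀)
  have hcount : 2 * E.card * (2 * ⌈(∑ j, P.σ j * P.A j) / P.wl 0⌉₊ + 1) * F.N ^ S.n ≤
      (P.L₀ + 1) * (F.C.det.natAbs * ∏ j, (2 * ⌊(F.N : ℝ) * P.σ j⌋₊ + 1)) := by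
    refine le_trans ?_ hL1
    have := Nat.mul_le_mul_left 2 hEcard
    exact Nat.mul_le_mul_right _ (Nat.mul_le_mul_right _ this)
  -- Hasse integrality and size
  have hR : ∀ q ∈ E, ∀ ℓ₀ ≤ P.L₀, ∃ z₀ : ℤ,
      (((fun q : ℤ × Tau S.n => Nat.lcmUpto P.H ^ q.2.1) q : ℕ) : ℚ) *
          (hasseDeriv q.2.1 (scaledFeldR ℓ₀ P.H (P.Sd - 0))).eval (q.1 : ℚ) = z₀ ∧ |z₀| ≤ (fun _ : ℤ × Tau S.n => S.M₀R P) q := by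
    intro q hq ℓ₀ hℓ₀
    rw [hEdef, mem_product, mem_Icc, mem_tauSetR] at hq
    obtain ⟨⟨hx1, hx2⟩, hτ, _⟩ := hq
    have ha : q.2.1 ≤ T₀ := by unfold tauNorm at hτ; omega
    refine exists_int_lcm_pow_mul_hasse_scaledFeldR ℓ₀ hH (P.Sd - 0) q.2.1 q.1 ?_
    rw [Nat.sub_zero]
    -- monotone bound by `ν(H)^{T₀} · WC H Ŝ L₀ T₀ X₀ ≤ M₀R`
    have hν1 : (1 : ℝ) ≤ (Nat.lcmUpto P.H : ℝ) := by exact_mod_cast Nat.lcmUpto_pos P.H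
    have hxR : |((2 ^ P.Sd * q.1 : ℤ) : ℝ)| ≤ (2 : ℝ) ^ P.Sd * (X₀ : ℝ) := by
      push_cast
      rw [abs_mul, abs_of_pos (by positivity : (0 : ℝ) < (2 : ℝ) ^ P.Sd)]
      refine mul_le_mul_of_nonneg_left ?_ (by positivity)
      rw [abs_le]; constructor <;> [exact_mod_cast hx1; exact_mod_cast hx2]
    have hH0 : (0 : ℝ) < P.H := by exact_mod_cast hH
    have hbase1 : 1 ≤ Real.exp 1 * (1 + |((2 ^ P.Sd * q.1 : ℤ) : ℝ)| / P.H) := by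
      have : (1 : ℝ) ≤ Real.exp 1 := by have := Real.add_one_le_exp (1 : ℝ); linarith
      have h2 : (0 : ℝ) ≤ |((2 ^ P.Sd * q.1 : ℤ) : ℝ)| / P.H := by positivity
      nlinarith
    have hbase : Real.exp 1 * (1 + |((2 ^ P.Sd * q.1 : ℤ) : ℝ)| / P.H) ≤ Real.exp 1 * (1 + (2 : ℝ) ^ P.Sd * (X₀ : ℝ) / P.H) :=
      mul_le_mul_of_nonneg_left (by gcongr) (Real.exp_pos 1).le
    have h1 : (Real.exp 1 * (1 + |((2 ^ P.Sd * q.1 : ℤ) : ℝ)| / P.H)) ^ ℓ₀ ≤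
        (Real.exp 1 * (1 + (2 : ℝ) ^ P.Sd * (X₀ : ℝ) / P.H)) ^ P.L₀ :=
      (pow_le_pow_left₀ (by positivity) hbase ℓ₀).trans (pow_le_pow_right₀ (hbase1.trans hbase) hℓ₀)
    have h2 : (2 : ℝ) ^ (P.Sd * q.2.1) ≤ (2 : ℝ) ^ (P.Sd * T₀) := pow_le_pow_right₀ (by norm_num) (Nat.mul_le_mul_left _ ha)
    have h3 : (Nat.lcmUpto P.H : ℝ) ^ q.2.1 ≤ (Nat.lcmUpto P.H : ℝ) ^ T₀ := pow_le_pow_right₀ hν1 ha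
    have hW : (2 : ℝ) ^ (P.Sd * q.2.1) * ((Nat.lcmUpto P.H : ℝ) ^ q.2.1 *
        (Real.exp (P.H / Real.exp 1) * (Real.exp 1 * (1 + |((2 ^ P.Sd * q.1 : ℤ) : ℝ)| / P.H)) ^ ℓ₀)) ≤
        ((Nat.lcmUpto P.H : ℝ) ^ T₀) * WC P.H P.Sd P.L₀ T₀ (X₀ : ℝ) := by
      unfold WC
      have e0 : (0 : ℝ) ≤ Real.exp (P.H / Real.exp 1) := (Real.exp_pos _).le
      calc (2 : ℝ) ^ (P.Sd * q.2.1) * ((Nat.lcmUpto P.H : ℝ) ^ q.2.1 *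
            (Real.exp (P.H / Real.exp 1) * (Real.exp 1 * (1 + |((2 ^ P.Sd * q.1 : ℤ) : ℝ)| / P.H)) ^ ℓ₀))
          ≤ (2 : ℝ) ^ (P.Sd * T₀) * ((Nat.lcmUpto P.H : ℝ) ^ T₀ *
            (Real.exp (P.H / Real.exp 1) * (Real.exp 1 * (1 + (2 : ℝ) ^ P.Sd * (X₀ : ℝ) / P.H)) ^ P.L₀)) := by
            gcongr
        _ = ((Nat.lcmUpto P.H : ℝ) ^ T₀) * ((2 : ℝ) ^ (P.Sd * T₀) *
            (Real.exp (P.H / Real.exp 1) * (Real.exp 1 * (1 + (2 : ℝ) ^ P.Sd * (X₀ : ℝ) / P.H)) ^ P.L₀)) := by ring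
    have hceil : ((Nat.lcmUpto P.H : ℝ) ^ T₀) * WC P.H P.Sd P.L₀ T₀ (X₀ : ℝ) ≤ (S.M₀R P : ℝ) := by
      unfold M₀R; exact Int.le_ceil _
    exact hW.trans hceil
  -- the Δ-weights on the doubled θ-box
  have hDΔ : ∀ w' : Fin S.n → ℤ, (∀ j, |w' j| ≤ ((2 * S.sθR F P j : ℕ) : ℤ)) → ∀ q ∈ E,
      |((∏ k, Ring.multichoose (S.yΔ (cl 0) (el 0) w' k) (q.2.2 k) : ℤ) : ℝ)| ≤
        DΔC (S.YC (cl 0) (el 0) fun j => 2 * S.sθR F P j) T₀ := by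
    intro w' hw' q hq
    rw [hEdef, mem_product, mem_tauSetR] at hq
    have haμ : q.2.1 + ∑ k, q.2.2 k < T₀ := by have := hq.2.1; unfold tauNorm at this; exact this
    exact S.abs_prod_multichoose_le_DΔC (cl 0) (el 0) (L := fun j => 2 * S.sθR F P j) hw' haμ
  -- the Siegel size
  have hDΔ0 : 0 ≤ DΔC (S.YC (cl 0) (el 0) fun j => 2 * S.sθR F P j) T₀ := DΔC_nonneg (S.YC_nonneg _ _ _) _
  have hM₀0 : (0 : ℝ) ≤ (S.M₀R P : ℝ) := by
    have h1 : (0 : ℝ) ≤ ((Nat.lcmUpto P.H : ℝ) ^ T₀) * WC P.H P.Sd P.L₀ T₀ (X₀ : ℝ) :=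
      mul_nonneg (by positivity) (WC_nonneg _ _ _ _ (by positivity))
    have h2 : ((Nat.lcmUpto P.H : ℝ) ^ T₀) * WC P.H P.Sd P.L₀ T₀ (X₀ : ℝ) ≤ (S.M₀R P : ℝ) := by unfold M₀R; exact Int.le_ceil _
    exact h1.trans h2
  have hAm : ∀ q ∈ E, DΔC (S.YC (cl 0) (el 0) fun j => 2 * S.sθR F P j) T₀ * ((fun _ : ℤ × Tau S.n => S.M₀R P) q : ℝ) *
      ((fun x => F.Dmv (S.LνR P 0) x) q.1 : ℝ) * Real.exp (P.wl 0 * X₀) ≤ S.AmaxR F P (cl 0) (el 0) := by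
    intro q hq
    rw [hEdef, mem_product] at hq
    have hD : F.Dmv (S.LνR P 0) q.1 ≤ S.DmvR F P := by
      unfold DmvR
      exact Finset.le_sup' (fun x => F.Dmv (S.LνR P 0) x) hq.1
    have hD' : (F.Dmv (S.LνR P 0) q.1 : ℝ) ≤ (S.DmvR F P : ℝ) := by exact_mod_cast hD
    unfold AmaxR
    refine le_trans ?_ (le_max_right _ _)
    exact mul_le_mul_of_nonneg_right (mul_le_mul_of_nonneg_left hD' (mul_nonneg hDΔ0 hM₀0)) (Real.exp_pos _).le
  -- the generic START at S(θ)
  exact S.archLevelStateQ_zero_sat F hAo P.σ hσ (S.LνR P) hLν0 (S.sθR F P) hs P.H P.Sd P.L₀ X₀ T₀ hT₀ P.wl P.γb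
    (P.wl_facts 0).2 (by rw [(P.γb_facts 0).1]; have := (P.wl_facts 0).2; have := (P.L_real).1; positivity) cl el hc he E hEdef
    hcount (fun q => Nat.lcmUpto P.H ^ q.2.1) (fun q _ => Nat.one_le_pow _ _ (Nat.lcmUpto_pos P.H)) (fun _ => S.M₀R P) hR hDΔ
    (le_max_left _ _) hAm

end ArchG3Setup

end Summit.ABC.StewartYu

end
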